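import Summits.AtomisticToContinuum.BoseEinsteinCondensation.Theorems.BECThomsonPrincipleFibreConductanceStubTwoScaleSplitHelpers
import Literature.MathematicalPhysics.QuantumManyBody.JelliumBochnerFibre
import HarnessLib

/-!
# Route `BECThomsonPrinciple`, crux `FibreConductance` (stmt-AtomisticToContinuum-9480),
# line `healing-split-kinetic-defect` — stub `stub_twoScaleSplit`, part II: THE TWO-SCALE BLOCK SPLIT

`stub_twoScaleSplit : TwoScaleSplit` (`BECThomsonPrincipleFibreConductanceHealingDefs`): for every
zero-free periodic state `Φ` (`L > 0`), block count `ν`, mode `n ≠ 0` and admissible triple `(σ, g, κ)`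
(`IsPoincareField`, `IsConductanceField`, `IsLatticeDualField`), the gradient charge `ε♭ = gradDefect n Φ`
has the dual bound `‖∫_{cellN} ε♭ η‖² ≤ (2ℓ²·cageIntegral σ + 12·coarseIntegral κ)·dualEnergy η` for every
test `η` (`ℓ = side L ν = L/(ν+1)`).

Proof (part I, `…StubTwoScaleSplitHelpers`, supplies the tiling of the fibre and the fibre tools): on
every fibre `η = (η − Πη) + Πη` with the block average `Πη(X) = ⨍_{Q(x₀)} η(·, X̂)` (notation `bAvg`).
* HIGH part (`high_fibre`, `high_sq_le`): on each cube Cauchy–Schwarz with the weights `1/ψ²`, `ψ²` and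
  the local Poincaré inequality of `σ`; Cauchy–Schwarz over the cubes (sums of cube integrals are cell
  integrals by the tiling) and over the bath with the weights `W`, `1/W`:
  `‖∫ε♭(η − Πη)‖² ≤ ℓ²·cageIntegral·dualEnergy`.
* LOW part (`low_fibre`, `low_sq_le`): `∫_cell ε♭Πη dy = Σ_Q c_Q ⨍_Qη` (cube charges), the lattice dual
  bound of `κ` with `a_Q = conj ⨍_Qη`, the edge conductances with `F = η`, `∫_{Q∪Q'} ≤ ∫_Q + ∫_{Q'}` and
  six directed edges per cube (`sum_edges`); then the Bochner fibre Fubini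
  `integral_cellN_integral_cell_update` and Cauchy–Schwarz over the bath:
  `‖∫ε♭Πη‖² ≤ 6·coarseIntegral·dualEnergy`.
* `‖a + b‖² ≤ 2‖a‖² + 2‖b‖²`.
Everything is organised in `ℝ≥0∞` with square roots `x^{1/2}`, so infinite field values need no cases.

References: the line card `Cruxes/FibreConductance/Lines/healing-split-kinetic-defect.md`; G. Grimmett,
H. Kesten, Y. Zhang, Probab. Theory Relat. Fields 96 (1993) §2, and R. Lyons, Y. Peres, *Probability on
Trees and Networks* (2016) Ch. 2 §2.4 — used only as ideas. All [folklore].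
-/

noncomputable section

namespace Summit.AtomisticToContinuum.BoseEinsteinCondensation.Cruxes.FibreConductance.HealingSplitKineticDefect

open MeasureTheory Set
open scoped ENNReal
open Literature.MathematicalPhysics.QuantumManyBody.BoseGas
open Summit.AtomisticToContinuum.BoseEinsteinCondensation.Cruxes.FibreConductance.ParsevalShellBootstrap

variable {m : ℕ} {L : ℝ}

/-! ### Notation for the fibre objects of a test function (no new definitions) -/

/-- `Πη(X) = ⨍_{Q(x₀)} η(·, X̂)`: the BLOCK AVERAGE, read at the cube of `x₀`. -/
local notation "bAvg[" L ", " ν ", " η ", " X "]" => cubeAvg L ν η (cubeIdx L ν (X 0)) X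

/-- `|∇₀η|²(X) = Σ_l ‖∂_{0,l}η(X)‖²`. -/
local notation "gSq[" η ", " X "]" => ∑ l : Fin 3, ‖fderiv ℝ η X (e0 _ l)‖ ^ 2

/-- `a(X̂) = ∫_cell σ_{Q(y)}(X̂) |ε♭(y, X̂)|²/ψ(y|X̂)² dy` (cage fibre integral). -/
local notation "cageF[" L ", " ν ", " σ ", " n ", " Φ ", " X "]" =>
  ∫⁻ y in cell L, σ (cubeIdx L ν y) X * ENNReal.ofReal
    (‖gradDefect n Φ (Function.update X 0 y)‖ ^ 2 / fibrePsi Φ (Function.update X 0 y) ^ 2)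

/-- `b(X̂) = ∫_cell |∇₀η(y, X̂)|² ψ(y|X̂)² dy` (energy fibre integral). -/
local notation "enF[" L ", " Φ ", " η ", " X "]" =>
  ∫⁻ y in cell L, ENNReal.ofReal ((∑ l : Fin 3, ‖fderiv ℝ η (Function.update X 0 y) (e0 _ l)‖ ^ 2) *
    fibrePsi Φ (Function.update X 0 y) ^ 2)

/-! ### HIGH part: `η − Πη`, cube by cube -/

/-- Per-fibre bound of the high part: `∫_cell |ε♭||η − Πη| dy ≤ ℓ · a(X̂)^{1/2} · b(X̂)^{1/2}`
(Cauchy–Schwarz on each cube, the local Poincaré inequality, Cauchy–Schwarz over the cubes). [folklore] -/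
theorem high_fibre (hL : 0 < L) {ν : ℕ} (n : Fin 3 → ℤ) (Φ : PeriodicTrialState (m + 1) L)
    (hΦ : ∀ X, Φ.ψ X ≠ 0) {σ : (Fin 3 → Fin (ν + 1)) → Config (m + 1) → ℝ≥0∞}
    (hσ : IsPoincareField L ν Φ σ) {η : Config (m + 1) → ℂ} (hη : IsTest L η) (X : Config (m + 1)) :
    ∫⁻ y in cell L, ENNReal.ofReal ‖gradDefect n Φ (Function.update X 0 y) *
        (η (Function.update X 0 y) - bAvg[L, ν, η, Function.update X 0 y])‖ ≤
      ENNReal.ofReal (side L ν ^ 2) ^ (1 / 2 : ℝ) * cageF[L, ν, σ, n, Φ, X] ^ (1 / 2 : ℝ) *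
        enF[L, Φ, η, X] ^ (1 / 2 : ℝ) := by
  have h2 : (0 : ℝ) ≤ 1 / 2 := by norm_num
  have hψ : ∀ Y, 0 < fibrePsi Φ Y := fibrePsi_pos hL Φ hΦ
  have hu : Continuous fun y : Space => Function.update X 0 y := continuous_const.update 0 continuous_id
  have hεu := (continuous_gradDefect hL n Φ hΦ).comp hu
  have hψu := (continuous_fibrePsi hL Φ hΦ).comp hu
  have hηu := hη.1.continuous.comp hu
  -- the two families of cube integrals
  set U : (Fin 3 → Fin (ν + 1)) → ℝ≥0∞ := fun Q => ∫⁻ y in cubeSet L ν Q, ENNReal.ofReal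
    (‖gradDefect n Φ (Function.update X 0 y)‖ ^ 2 / fibrePsi Φ (Function.update X 0 y) ^ 2) with hU
  set V : (Fin 3 → Fin (ν + 1)) → ℝ≥0∞ := fun Q => ∫⁻ y in cubeSet L ν Q, ENNReal.ofReal
    (gSq[η, Function.update X 0 y] * fibrePsi Φ (Function.update X 0 y) ^ 2) with hV
  have hUm : Measurable fun y : Space => ENNReal.ofReal
      (‖gradDefect n Φ (Function.update X 0 y)‖ ^ 2 / fibrePsi Φ (Function.update X 0 y) ^ 2) :=
    ((hεu.norm.pow 2).measurable.div (hψu.pow 2).measurable).ennreal_ofReal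
  have ha : cageF[L, ν, σ, n, Φ, X] = ∑ Q, σ Q X * U Q := by
    rw [lintegral_cell_eq_sum hL ν]
    refine Finset.sum_congr rfl fun Q _ => ?_
    rw [hU, ← lintegral_const_mul _ hUm]
    exact setLIntegral_congr_fun (measurableSet_cubeSet L ν Q) fun y hy => by
      rw [cubeIdx_of_mem_cubeSet hL hy]
  have hb : enF[L, Φ, η, X] = ∑ Q, V Q := lintegral_cell_eq_sum hL ν _
  -- per cube: Cauchy–Schwarz and Poincaré
  have hcube : ∀ Q, ∫⁻ y in cubeSet L ν Q, ENNReal.ofReal ‖gradDefect n Φ (Function.update X 0 y) *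
      (η (Function.update X 0 y) - bAvg[L, ν, η, Function.update X 0 y])‖ ≤
      ENNReal.ofReal (side L ν ^ 2) ^ (1 / 2 : ℝ) * ((σ Q X * U Q) ^ (1 / 2 : ℝ) * V Q ^ (1 / 2 : ℝ)) := by
    intro Q
    have hgc : Continuous fun y : Space => ‖η (Function.update X 0 y) - cubeAvg L ν η Q X‖ ^ 2 *
        fibrePsi Φ (Function.update X 0 y) ^ 2 := ((hηu.sub continuous_const).norm.pow 2).mul (hψu.pow 2)
    have hP : ∫⁻ y in cubeSet L ν Q, ENNReal.ofReal (‖η (Function.update X 0 y) - cubeAvg L ν η Q X‖ ^ 2 *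
        fibrePsi Φ (Function.update X 0 y) ^ 2) ≤ σ Q X * (ENNReal.ofReal (side L ν ^ 2) * V Q) := by
      rw [← ofReal_integral_eq_lintegral_ofReal (integrableOn_cubeSet hL Q hgc)
        (Filter.Eventually.of_forall fun y => by positivity)]
      have h := hσ.2.2 Q X η hη
      rwa [ENNReal.ofReal_mul (sq_nonneg _),
        ofReal_locEnergy hL Φ hΦ hη.1 (cubeSet_subset_cell hL Q) X] at h
    calc ∫⁻ y in cubeSet L ν Q, ENNReal.ofReal ‖gradDefect n Φ (Function.update X 0 y) *
          (η (Function.update X 0 y) - bAvg[L, ν, η, Function.update X 0 y])‖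
        = ∫⁻ y in cubeSet L ν Q, ENNReal.ofReal (‖gradDefect n Φ (Function.update X 0 y)‖ ^ 2 /
              fibrePsi Φ (Function.update X 0 y) ^ 2) ^ (1 / 2 : ℝ) *
            ENNReal.ofReal (‖η (Function.update X 0 y) - cubeAvg L ν η Q X‖ ^ 2 *
              fibrePsi Φ (Function.update X 0 y) ^ 2) ^ (1 / 2 : ℝ) :=
          setLIntegral_congr_fun (measurableSet_cubeSet L ν Q) fun y hy => by
            rw [blockAvg_update hL X hy, norm_mul,
              ofReal_mul_eq_sqrt_mul_sqrt (norm_nonneg _) (norm_nonneg _) (hψ _)]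
      _ ≤ U Q ^ (1 / 2 : ℝ) * (∫⁻ y in cubeSet L ν Q, ENNReal.ofReal
            (‖η (Function.update X 0 y) - cubeAvg L ν η Q X‖ ^ 2 *
              fibrePsi Φ (Function.update X 0 y) ^ 2)) ^ (1 / 2 : ℝ) :=
          lintegral_sqrt_mul_sqrt_le _ hUm.aemeasurable hgc.measurable.ennreal_ofReal.aemeasurable
      _ ≤ U Q ^ (1 / 2 : ℝ) * (σ Q X * (ENNReal.ofReal (side L ν ^ 2) * V Q)) ^ (1 / 2 : ℝ) := by
          gcongr
      _ = _ := by
          simp only [ENNReal.mul_rpow_of_nonneg _ _ h2]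
          ring
  -- sum over the cubes
  calc ∫⁻ y in cell L, ENNReal.ofReal ‖gradDefect n Φ (Function.update X 0 y) *
        (η (Function.update X 0 y) - bAvg[L, ν, η, Function.update X 0 y])‖
      = ∑ Q, ∫⁻ y in cubeSet L ν Q, ENNReal.ofReal ‖gradDefect n Φ (Function.update X 0 y) *
          (η (Function.update X 0 y) - bAvg[L, ν, η, Function.update X 0 y])‖ :=
        lintegral_cell_eq_sum hL ν _
    _ ≤ ∑ Q, ENNReal.ofReal (side L ν ^ 2) ^ (1 / 2 : ℝ) *
          ((σ Q X * U Q) ^ (1 / 2 : ℝ) * V Q ^ (1 / 2 : ℝ)) := Finset.sum_le_sum fun Q _ => hcube Q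
    _ = ENNReal.ofReal (side L ν ^ 2) ^ (1 / 2 : ℝ) *
          ∑ Q, (σ Q X * U Q) ^ (1 / 2 : ℝ) * V Q ^ (1 / 2 : ℝ) := by rw [← Finset.mul_sum]
    _ ≤ ENNReal.ofReal (side L ν ^ 2) ^ (1 / 2 : ℝ) *
          ((∑ Q, σ Q X * U Q) ^ (1 / 2 : ℝ) * (∑ Q, V Q) ^ (1 / 2 : ℝ)) := by
        gcongr
        exact sum_sqrt_mul_sqrt_le _ _ _
    _ = _ := by rw [ha, hb, mul_assoc]

/-- **The high part**: `‖∫_{cellN} ε♭ (η − Πη)‖² ≤ ℓ² · cageIntegral · dualEnergy`. [folklore] -/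
theorem high_sq_le (hL : 0 < L) {ν : ℕ} (n : Fin 3 → ℤ) (Φ : PeriodicTrialState (m + 1) L)
    (hΦ : ∀ X, Φ.ψ X ≠ 0) {σ : (Fin 3 → Fin (ν + 1)) → Config (m + 1) → ℝ≥0∞}
    (hσ : IsPoincareField L ν Φ σ) {η : Config (m + 1) → ℂ} (hη : IsTest L η) :
    ENNReal.ofReal (‖∫ X in cellN (m + 1) L, gradDefect n Φ X * (η X - bAvg[L, ν, η, X])‖ ^ 2) ≤
      ENNReal.ofReal (side L ν ^ 2) * cageIntegral L ν σ n Φ * dualEnergy Φ η := by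
  have h2 : (0 : ℝ) ≤ 1 / 2 := by norm_num
  set c : ℝ≥0∞ := ENNReal.ofReal L ^ 3 with hc
  have hc0 : c ≠ 0 := pow_ne_zero _ (ENNReal.ofReal_pos.2 hL).ne'
  have hct : c ≠ ⊤ := ENNReal.pow_ne_top ENNReal.ofReal_ne_top
  have hmeas : Measurable fun X => ENNReal.ofReal ‖gradDefect n Φ X * (η X - bAvg[L, ν, η, X])‖ :=
    ((continuous_gradDefect hL n Φ hΦ).measurable.mul (hη.1.continuous.measurable.sub
      (measurable_blockAvg hL ν hη.1.continuous))).norm.ennreal_ofReal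
  have hW0 : ∀ X, ENNReal.ofReal (fibreW Φ X) ≠ 0 := fun X =>
    (ENNReal.ofReal_pos.2 (fibreW_pos hL Φ hΦ X)).ne'
  rw [ENNReal.ofReal_pow (norm_nonneg _)]
  refine sq_le_of_le_sqrt ((ENNReal.mul_le_mul_iff_right hc0 hct).1 ?_)
  calc c * ENNReal.ofReal ‖∫ X in cellN (m + 1) L, gradDefect n Φ X * (η X - bAvg[L, ν, η, X])‖
      ≤ c * ∫⁻ X in cellN (m + 1) L,
          ENNReal.ofReal ‖gradDefect n Φ X * (η X - bAvg[L, ν, η, X])‖ := by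
        gcongr
        exact ofReal_norm_integral_le _ _
    _ = ∫⁻ X in cellN (m + 1) L, ∫⁻ y in cell L, ENNReal.ofReal
          ‖gradDefect n Φ (Function.update X 0 y) *
            (η (Function.update X 0 y) - bAvg[L, ν, η, Function.update X 0 y])‖ :=
        (lintegral_cellN_lintegral_update 0 hmeas).symm
    _ ≤ ∫⁻ X in cellN (m + 1) L, ENNReal.ofReal (side L ν ^ 2) ^ (1 / 2 : ℝ) *
          (cageF[L, ν, σ, n, Φ, X] ^ (1 / 2 : ℝ) * enF[L, Φ, η, X] ^ (1 / 2 : ℝ)) :=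
        lintegral_mono fun X => (high_fibre hL n Φ hΦ hσ hη X).trans_eq (mul_assoc _ _ _)
    _ = ENNReal.ofReal (side L ν ^ 2) ^ (1 / 2 : ℝ) * ∫⁻ X in cellN (m + 1) L,
          cageF[L, ν, σ, n, Φ, X] ^ (1 / 2 : ℝ) * enF[L, Φ, η, X] ^ (1 / 2 : ℝ) :=
        lintegral_const_mul' _ _ (ENNReal.rpow_ne_top_of_nonneg h2 ENNReal.ofReal_ne_top)
    _ ≤ ENNReal.ofReal (side L ν ^ 2) ^ (1 / 2 : ℝ) *
          ((∫⁻ X in cellN (m + 1) L, cageF[L, ν, σ, n, Φ, X] * ENNReal.ofReal (fibreW Φ X)) ^ (1 / 2 : ℝ) *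
            (∫⁻ X in cellN (m + 1) L, enF[L, Φ, η, X] * (ENNReal.ofReal (fibreW Φ X))⁻¹) ^
              (1 / 2 : ℝ)) := by
        gcongr
        exact lintegral_sqrt_mul_sqrt_le_weighted _ (measurable_cageFibre hL n Φ hΦ hσ).aemeasurable
          (measurable_energyFibre hL Φ hΦ hη.1).aemeasurable
          (measurable_fibreW Φ).ennreal_ofReal.aemeasurable hW0 fun _ => ENNReal.ofReal_ne_top
    _ = (c ^ (1 / 2 : ℝ)) ^ 2 * (ENNReal.ofReal (side L ν ^ 2) ^ (1 / 2 : ℝ) *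
          cageIntegral L ν σ n Φ ^ (1 / 2 : ℝ) * dualEnergy Φ η ^ (1 / 2 : ℝ)) := by
        rw [lintegral_cageFibre_mul hL n Φ hΦ hσ, lintegral_energyFibre_mul hL Φ hΦ hη.1,
          ENNReal.mul_rpow_of_nonneg _ _ h2, ENNReal.mul_rpow_of_nonneg _ _ h2]
        ring
    _ = _ := by rw [← ENNReal.rpow_natCast, ← ENNReal.rpow_mul]; norm_num

/-! ### LOW part: `Πη`, the cube lattice -/

/-- Six directed edges per cube on the periodic cube lattice `(ℤ/(ν+1))³`:
`Σ_Q Σ_l (V_Q + V_{Q+e_l}) = 6 Σ_Q V_Q`. [folklore] -/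
theorem sum_edges {ν : ℕ} (V : (Fin 3 → Fin (ν + 1)) → ℝ≥0∞) :
    ∑ Q, ∑ l : Fin 3, (V Q + V (Q + Pi.single l 1)) = 6 * ∑ Q, V Q := by
  have hsh : ∀ l : Fin 3, ∑ Q, V (Q + Pi.single l 1) = ∑ Q, V Q := fun l => by
    simpa only [Equiv.coe_addRight] using
      Equiv.sum_comp (Equiv.addRight (Pi.single l (1 : Fin (ν + 1)))) V
  calc ∑ Q, ∑ l : Fin 3, (V Q + V (Q + Pi.single l 1))
      = ∑ l : Fin 3, ((∑ Q, V Q) + ∑ Q, V (Q + Pi.single l 1)) := by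
        rw [Finset.sum_comm]; exact Finset.sum_congr rfl fun l _ => Finset.sum_add_distrib
    _ = ∑ _l : Fin 3, 2 * ∑ Q, V Q := Finset.sum_congr rfl fun l _ => by rw [hsh, two_mul]
    _ = 6 * ∑ Q, V Q := by
        rw [Finset.sum_const, Finset.card_univ, Fintype.card_fin, nsmul_eq_mul]; ring


/-- Per-fibre bound of the low part: `‖∫_cell ε♭ Πη dy‖ = ‖Σ_Q c_Q ⨍_Qη‖ ≤ (6 κ(X̂) b(X̂))^{1/2}`
(lattice dual norm with `a_Q = conj ⨍_Qη`, edge conductances, six directed edges per cube). [folklore] -/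
theorem low_fibre (hL : 0 < L) {ν : ℕ} (n : Fin 3 → ℤ) (Φ : PeriodicTrialState (m + 1) L)
    (hΦ : ∀ X, Φ.ψ X ≠ 0) {g : (Fin 3 → Fin (ν + 1)) → Fin 3 → Config (m + 1) → ℝ≥0∞}
    {κ : Config (m + 1) → ℝ≥0∞} (hg : IsConductanceField L ν Φ g)
    (hκ : IsLatticeDualField L ν n Φ g κ) {η : Config (m + 1) → ℂ} (hη : IsTest L η)
    (X : Config (m + 1)) :
    ENNReal.ofReal ‖∫ y in cell L, gradDefect n Φ (Function.update X 0 y) *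
        bAvg[L, ν, η, Function.update X 0 y]‖ ≤
      (6 : ℝ≥0∞) ^ (1 / 2 : ℝ) * (κ X ^ (1 / 2 : ℝ) * enF[L, Φ, η, X] ^ (1 / 2 : ℝ)) := by
  have h2 : (0 : ℝ) ≤ 1 / 2 := by norm_num
  have hu : Continuous fun y : Space => Function.update X 0 y := continuous_const.update 0 continuous_id
  have hεu := (continuous_gradDefect hL n Φ hΦ).comp hu
  set V : (Fin 3 → Fin (ν + 1)) → ℝ≥0∞ := fun Q => ∫⁻ y in cubeSet L ν Q, ENNReal.ofReal
    (gSq[η, Function.update X 0 y] * fibrePsi Φ (Function.update X 0 y) ^ 2) with hV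
  have hb : enF[L, Φ, η, X] = ∑ Q, V Q := lintegral_cell_eq_sum hL ν _
  -- the fibre integral is the lattice pairing `Σ_Q c_Q A_Q`
  have hint : ∀ Q, IntegrableOn (fun y => gradDefect n Φ (Function.update X 0 y) *
      bAvg[L, ν, η, Function.update X 0 y]) (cubeSet L ν Q) := fun Q => by
    have hc : Continuous fun y => gradDefect n Φ (Function.update X 0 y) * cubeAvg L ν η Q X :=
      hεu.mul continuous_const
    exact (integrableOn_cubeSet hL Q hc).congr_fun (fun y hy => by rw [blockAvg_update hL X hy])
      (measurableSet_cubeSet L ν Q)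
  have hid : ∫ y in cell L, gradDefect n Φ (Function.update X 0 y) *
      bAvg[L, ν, η, Function.update X 0 y] =
      ∑ Q, cubeCharge L ν n Φ Q X * cubeAvg L ν η Q X := by
    rw [integral_cell_eq_sum hL ν hint]
    refine Finset.sum_congr rfl fun Q _ => ?_
    rw [cubeCharge, ← integral_mul_const]
    exact setIntegral_congr_fun (measurableSet_cubeSet L ν Q) fun y hy => by
      rw [blockAvg_update hL X hy]
  -- lattice dual bound, edge conductances, six edges per cube
  have h1 := hκ.2.2 X fun Q => (starRingEnd ℂ) (cubeAvg L ν η Q X)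
  simp only [starRingEnd_self_apply] at h1
  have hedge : ∀ (Q : Fin 3 → Fin (ν + 1)) (l : Fin 3),
      g Q l X * ENNReal.ofReal (‖(starRingEnd ℂ) (cubeAvg L ν η (Q + Pi.single l 1) X) -
        (starRingEnd ℂ) (cubeAvg L ν η Q X)‖ ^ 2) ≤ V Q + V (Q + Pi.single l 1) := by
    intro Q l
    calc g Q l X * ENNReal.ofReal (‖(starRingEnd ℂ) (cubeAvg L ν η (Q + Pi.single l 1) X) -
          (starRingEnd ℂ) (cubeAvg L ν η Q X)‖ ^ 2)
        = g Q l X * ENNReal.ofReal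
            (‖cubeAvg L ν η Q X - cubeAvg L ν η (Q + Pi.single l 1) X‖ ^ 2) := by
          rw [← map_sub, Complex.norm_conj, norm_sub_rev]
      _ ≤ ENNReal.ofReal (locEnergy Φ (cubeSet L ν Q ∪ cubeSet L ν (Q + Pi.single l 1)) η X) :=
          hg.2.2 Q l X η hη
      _ = ∫⁻ y in cubeSet L ν Q ∪ cubeSet L ν (Q + Pi.single l 1), ENNReal.ofReal
            (gSq[η, Function.update X 0 y] * fibrePsi Φ (Function.update X 0 y) ^ 2) :=
          ofReal_locEnergy hL Φ hΦ hη.1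
            (union_subset (cubeSet_subset_cell hL _) (cubeSet_subset_cell hL _)) X
      _ ≤ V Q + V (Q + Pi.single l 1) := lintegral_union_le _ _ _
  have hsix : ∑ Q, ∑ l : Fin 3, (V Q + V (Q + Pi.single l 1)) = 6 * enF[L, Φ, η, X] := by
    rw [sum_edges, hb]
  have h4 : ENNReal.ofReal ‖∑ Q, cubeCharge L ν n Φ Q X * cubeAvg L ν η Q X‖ ^ 2 ≤
      6 * (κ X * enF[L, Φ, η, X]) := by
    rw [← ENNReal.ofReal_pow (norm_nonneg _)]
    calc _ ≤ _ := h1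
      _ ≤ κ X * ∑ Q, ∑ l : Fin 3, (V Q + V (Q + Pi.single l 1)) := by
          gcongr with Q _ l _
          exact hedge Q l
      _ = 6 * (κ X * enF[L, Φ, η, X]) := by rw [hsix]; ring
  rw [hid]
  have e : ∀ y : ℝ≥0∞, (y ^ 2) ^ (1 / 2 : ℝ) = y := fun y => by
    rw [← ENNReal.rpow_natCast, ← ENNReal.rpow_mul]; norm_num
  calc ENNReal.ofReal ‖∑ Q, cubeCharge L ν n Φ Q X * cubeAvg L ν η Q X‖
      = (ENNReal.ofReal ‖∑ Q, cubeCharge L ν n Φ Q X * cubeAvg L ν η Q X‖ ^ 2) ^ (1 / 2 : ℝ) :=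
        (e _).symm
    _ ≤ (6 * (κ X * enF[L, Φ, η, X])) ^ (1 / 2 : ℝ) := ENNReal.rpow_le_rpow h4 h2
    _ = _ := by rw [ENNReal.mul_rpow_of_nonneg _ _ h2, ENNReal.mul_rpow_of_nonneg _ _ h2]

/-- **The low part**: `‖∫_{cellN} ε♭ Πη‖² ≤ 6 · coarseIntegral · dualEnergy`. [folklore] -/
theorem low_sq_le (hL : 0 < L) {ν : ℕ} (n : Fin 3 → ℤ) (Φ : PeriodicTrialState (m + 1) L)
    (hΦ : ∀ X, Φ.ψ X ≠ 0) {g : (Fin 3 → Fin (ν + 1)) → Fin 3 → Config (m + 1) → ℝ≥0∞}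
    {κ : Config (m + 1) → ℝ≥0∞} (hg : IsConductanceField L ν Φ g)
    (hκ : IsLatticeDualField L ν n Φ g κ) {η : Config (m + 1) → ℂ} (hη : IsTest L η) :
    ENNReal.ofReal (‖∫ X in cellN (m + 1) L, gradDefect n Φ X * bAvg[L, ν, η, X]‖ ^ 2) ≤
      6 * coarseIntegral Φ κ * dualEnergy Φ η := by
  have h2 : (0 : ℝ) ≤ 1 / 2 := by norm_num
  set c : ℝ≥0∞ := ENNReal.ofReal L ^ 3 with hc
  have hc0 : c ≠ 0 := pow_ne_zero _ (ENNReal.ofReal_pos.2 hL).ne'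
  have hct : c ≠ ⊤ := ENNReal.pow_ne_top ENNReal.ofReal_ne_top
  have hW0 : ∀ X, ENNReal.ofReal (fibreW Φ X) ≠ 0 := fun X =>
    (ENNReal.ofReal_pos.2 (fibreW_pos hL Φ hΦ X)).ne'
  have hF := Literature.MathematicalPhysics.QuantumManyBody.JelliumBoseGas.integral_cellN_integral_cell_update
    0 (integrableOn_gradDefect_mul_blockAvg hL ν n Φ hΦ hη.1.continuous)
  rw [ENNReal.ofReal_pow (norm_nonneg _)]
  refine sq_le_of_le_sqrt ((ENNReal.mul_le_mul_iff_right hc0 hct).1 ?_)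
  calc c * ENNReal.ofReal ‖∫ X in cellN (m + 1) L, gradDefect n Φ X * bAvg[L, ν, η, X]‖
      = ENNReal.ofReal ‖∫ X in cellN (m + 1) L, ∫ y in cell L,
          gradDefect n Φ (Function.update X 0 y) * bAvg[L, ν, η, Function.update X 0 y]‖ := by
        rw [hF, norm_smul, Real.norm_of_nonneg (by positivity), ENNReal.ofReal_mul (by positivity),
          ENNReal.ofReal_pow hL.le]
    _ ≤ ∫⁻ X in cellN (m + 1) L, ENNReal.ofReal ‖∫ y in cell L,
          gradDefect n Φ (Function.update X 0 y) * bAvg[L, ν, η, Function.update X 0 y]‖ :=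
        ofReal_norm_integral_le _ _
    _ ≤ ∫⁻ X in cellN (m + 1) L, (6 : ℝ≥0∞) ^ (1 / 2 : ℝ) *
          (κ X ^ (1 / 2 : ℝ) * enF[L, Φ, η, X] ^ (1 / 2 : ℝ)) :=
        lintegral_mono fun X => low_fibre hL n Φ hΦ hg hκ hη X
    _ = (6 : ℝ≥0∞) ^ (1 / 2 : ℝ) * ∫⁻ X in cellN (m + 1) L,
          κ X ^ (1 / 2 : ℝ) * enF[L, Φ, η, X] ^ (1 / 2 : ℝ) :=
        lintegral_const_mul' _ _ (ENNReal.rpow_ne_top_of_nonneg h2 (by simp))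
    _ ≤ (6 : ℝ≥0∞) ^ (1 / 2 : ℝ) *
          ((∫⁻ X in cellN (m + 1) L, κ X * ENNReal.ofReal (fibreW Φ X)) ^ (1 / 2 : ℝ) *
            (∫⁻ X in cellN (m + 1) L, enF[L, Φ, η, X] * (ENNReal.ofReal (fibreW Φ X))⁻¹) ^
              (1 / 2 : ℝ)) := by
        gcongr
        exact lintegral_sqrt_mul_sqrt_le_weighted _ hκ.1.aemeasurable
          (measurable_energyFibre hL Φ hΦ hη.1).aemeasurable
          (measurable_fibreW Φ).ennreal_ofReal.aemeasurable hW0 fun _ => ENNReal.ofReal_ne_top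
    _ = (c ^ (1 / 2 : ℝ)) ^ 2 * ((6 : ℝ≥0∞) ^ (1 / 2 : ℝ) *
          coarseIntegral Φ κ ^ (1 / 2 : ℝ) * dualEnergy Φ η ^ (1 / 2 : ℝ)) := by
        rw [lintegral_kappa_mul Φ hκ.1 hκ.2.1, lintegral_energyFibre_mul hL Φ hΦ hη.1,
          ENNReal.mul_rpow_of_nonneg _ _ h2, ENNReal.mul_rpow_of_nonneg _ _ h2]
        ring
    _ = _ := by rw [← ENNReal.rpow_natCast, ← ENNReal.rpow_mul]; norm_num

/-! ### The registered stub -/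

/-- **`stub_twoScaleSplit` — THE TWO-SCALE BLOCK SPLIT.** For every zero-free state, block count
`ν`, mode `n ≠ 0` and admissible triple `(σ, g, κ)` of local Poincaré factors, edge conductances
and lattice dual norms: `‖∫ε♭η‖² ≤ (2ℓ²·cageIntegral σ + 12·coarseIntegral κ)·E(η)` for all test
`η`. Proof: `η = (η − Πη) + Πη` with the block average `Πη` (notation `bAvg`); the high part is
`high_sq_le` (Cauchy–Schwarz per cube, `IsPoincareField`, Cauchy–Schwarz over cubes and the bath with
weights `W`, `1/W`), the low part is `low_sq_le` (`IsLatticeDualField` with `a_Q = conj ⨍_Qη`,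
`IsConductanceField`, six directed edges per cube, Cauchy–Schwarz over the bath), and
`‖a + b‖² ≤ 2‖a‖² + 2‖b‖²`. (Refs: GrimmettKestenZhang1993 §2; LyonsPeres2016 Ch. 2 §2.4 — ideas only.)
[folklore] -/
theorem stub_twoScaleSplit : Goal.stub_twoScaleSplit := by
  intro m L hL ν n _hn Φ hΦ σ g κ hσ hg hκ η hη
  have hI₁ := high_sq_le hL n Φ hΦ hσ hη
  have hI₂ := low_sq_le hL n Φ hΦ hg hκ hη
  set I₁ := ∫ X in cellN (m + 1) L, gradDefect n Φ X * (η X - bAvg[L, ν, η, X])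
  set I₂ := ∫ X in cellN (m + 1) L, gradDefect n Φ X * bAvg[L, ν, η, X]
  have hP := integrableOn_gradDefect_mul_blockAvg hL ν n Φ hΦ hη.1.continuous
  have hηi : IntegrableOn (fun X => gradDefect n Φ X * η X) (cellN (m + 1) L) :=
    integrableOn_cellN ((continuous_gradDefect hL n Φ hΦ).mul hη.1.continuous) L
  have hsplit : ∫ X in cellN (m + 1) L, gradDefect n Φ X * η X = I₁ + I₂ := by
    rw [← integral_add ((hηi.sub hP).congr (Filter.Eventually.of_forall fun X => by
      simp only [Pi.sub_apply]; ring)) hP]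
    exact integral_congr_ae (Filter.Eventually.of_forall fun X => by ring)
  rw [hsplit]
  calc ENNReal.ofReal (‖I₁ + I₂‖ ^ 2) ≤ ENNReal.ofReal (2 * ‖I₁‖ ^ 2 + 2 * ‖I₂‖ ^ 2) := by
        refine ENNReal.ofReal_le_ofReal ?_
        nlinarith [norm_add_le I₁ I₂, norm_nonneg (I₁ + I₂), norm_nonneg I₁, norm_nonneg I₂,
          sq_nonneg (‖I₁‖ - ‖I₂‖)]
    _ = 2 * ENNReal.ofReal (‖I₁‖ ^ 2) + 2 * ENNReal.ofReal (‖I₂‖ ^ 2) := by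
        rw [ENNReal.ofReal_add (by positivity) (by positivity), ENNReal.ofReal_mul zero_le_two,
          ENNReal.ofReal_mul zero_le_two, ENNReal.ofReal_ofNat]
    _ ≤ 2 * (ENNReal.ofReal (side L ν ^ 2) * cageIntegral L ν σ n Φ * dualEnergy Φ η) +
          2 * (6 * coarseIntegral Φ κ * dualEnergy Φ η) := by gcongr
    _ = (2 * ENNReal.ofReal (side L ν ^ 2) * cageIntegral L ν σ n Φ + 12 * coarseIntegral Φ κ) *
          dualEnergy Φ η := by ring

end Summit.AtomisticToContinuum.BoseEinsteinCondensation.Cruxes.FibreConductance.HealingSplitKineticDefect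

end
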